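import Mathlib
import HarnessLib

/-!
# Halving a rational point over a quadratic field: the HALVING QUARTIC
# (helper for the refutation of Q5 `EquivariantChebotarevAtTwo`, stmt-BirchSwinnertonDyer-24881;
# seat gk2-p2 g8; route-independent — no `Theses` import)

For a Weierstrass curve `E` over a field and an affine point `R = (x, y)` with `2R ≠ O`, the
duplication formula (Silverman AEC III.2.3 (d)) reads
`x(2R) · (4x³ + b₂x² + 2b₄x + b₆) = x⁴ − b₄x² − 2b₆x − b₈`. Hence every "half" `R` of a point `P`
(`R + R = P`) has `x(R)` a root of the **halving quartic**
`q_P(X) = X⁴ − b₄X² − 2b₆X − b₈ − x(P)·(4X³ + b₂X² + 2b₄X + b₆)`. If `E` and `P` are defined over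
`ℚ` and `q_P ∈ ℚ[X]` is IRREDUCIBLE, then `x(R)` has degree `4` over `ℚ`, so `P` has no half over
any number field of degree `2` — the tool by which the Kummer classes `κ_K(P) ∈ H¹(K, E[2])` of
rational points are shown non-zero over a quadratic field `K` (sequel `…KummerInvariant`,
`…Refutation`). Irreducibility of an explicit integer quartic is certified modulo a prime `p` by two
`decide`-shaped checks: no root in `𝔽_p`, and no monic quadratic factor (remainder of the division by
`X² + aX + b` non-zero for all `a, b ∈ 𝔽_p`).

* §1 `addX_self_mul_eq` — the duplication formula for `x(2R)`; `exists_halvingQuartic_eq_zero`.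
* §2 `irreducible_quartic_of_certificate` (any field), `irreducible_quartic_rat_of_certificate`
  (ℤ → ℚ via reduction mod `p` and Gauss's lemma).
* §3 `not_exists_add_self_eq_of_irreducible` — no half over a quadratic number field.

THEOREMS ONLY (no definition, no named fact, no `sorry`); helper `--supports 24881`; BSD is not
proved by any of this.

References: [SilvermanAEC2009] III.2.3 (d) (duplication formula), VIII.1 (halving and `E(K)/2E(K)`);
[Cassels1991LMSST24] §13 (2-descent via `x`-coordinates of halves).
-/

set_option autoImplicit false
set_option linter.dupNamespace false

noncomputable section

open scoped Classical
open Polynomial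

namespace Summit.BirchSwinnertonDyer.BirchSwinnertonDyer.Theorems.GenusExact

/-! ### §1 The duplication formula and the halving quartic -/

section Doubling

variable {F : Type*} [Field F] (W : WeierstrassCurve.Affine F)

/-- **Duplication formula for the `x`-coordinate** (Silverman AEC III.2.3 (d)): for a nonsingular
affine point `(x, y)` with `2(x, y) ≠ O` (i.e. `y ≠ −y − a₁x − a₃`),
`x(2R) · (4x³ + b₂x² + 2b₄x + b₆) = x⁴ − b₄x² − 2b₆x − b₈`, where `x(2R) = addX x x (slope x x y y)`
and `4x³ + b₂x² + 2b₄x + b₆ = (2y + a₁x + a₃)²`. [cite: SilvermanAEC2009, III.2.3 (d)] -/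
theorem addX_self_mul_eq {x y : F} (h : W.Nonsingular x y) (hy : y ≠ W.negY x y) :
    W.addX x x (W.slope x x y y) * (4 * x ^ 3 + W.b₂ * x ^ 2 + 2 * W.b₄ * x + W.b₆) =
      x ^ 4 - W.b₄ * x ^ 2 - 2 * W.b₆ * x - W.b₈ := by
  have heq : y ^ 2 + W.a₁ * x * y + W.a₃ * y = x ^ 3 + W.a₂ * x ^ 2 + W.a₄ * x + W.a₆ :=
    (W.equation_iff x y).mp h.1
  have hd : y - W.negY x y ≠ 0 := sub_ne_zero.mpr hy
  have hd' : y - W.negY x y = 2 * y + W.a₁ * x + W.a₃ := by rw [WeierstrassCurve.Affine.negY]; ring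
  have hd2 : (y - W.negY x y) ^ 2 = 4 * x ^ 3 + W.b₂ * x ^ 2 + 2 * W.b₄ * x + W.b₆ := by
    rw [hd', WeierstrassCurve.b₂, WeierstrassCurve.b₄, WeierstrassCurve.b₆]
    linear_combination 4 * heq
  rw [← hd2]
  have key : W.addX x x (W.slope x x y y) * (y - W.negY x y) ^ 2 =
      (W.slope x x y y * (y - W.negY x y)) ^ 2 +
        W.a₁ * (W.slope x x y y * (y - W.negY x y)) * (y - W.negY x y) -
        (W.a₂ + 2 * x) * (y - W.negY x y) ^ 2 := by
    simp only [WeierstrassCurve.Affine.addX]; ring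
  rw [key, W.slope_of_Y_ne rfl hy, div_mul_cancel₀ _ hd, hd', WeierstrassCurve.b₄,
    WeierstrassCurve.b₆, WeierstrassCurve.b₈]
  linear_combination (-(W.a₁ ^ 2 + 4 * W.a₂ + 8 * x)) * heq

/-- **Every half of an affine point has `x`-coordinate a root of the halving quartic**: if
`R + R = (x_P, y_P)` then `R = (x, y)` is affine, `2R ≠ O`, and
`x⁴ − b₄x² − 2b₆x − b₈ − x_P (4x³ + b₂x² + 2b₄x + b₆) = 0`. [cite: SilvermanAEC2009, III.2.3 (d)] -/
theorem exists_halvingQuartic_eq_zero {R : W.Point} {xP yP : F} {hP : W.Nonsingular xP yP}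
    (h2 : R + R = .some xP yP hP) :
    ∃ (x y : F) (h : W.Nonsingular x y), R = .some x y h ∧
      x ^ 4 - W.b₄ * x ^ 2 - 2 * W.b₆ * x - W.b₈ -
        xP * (4 * x ^ 3 + W.b₂ * x ^ 2 + 2 * W.b₄ * x + W.b₆) = 0 := by
  rcases R with _ | ⟨x, y, h⟩
  · rw [← WeierstrassCurve.Affine.Point.zero_def, add_zero] at h2
    exact absurd h2.symm (WeierstrassCurve.Affine.Point.some_ne_zero hP)
  · refine ⟨x, y, h, rfl, ?_⟩
    by_cases hy : y = W.negY x y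
    · rw [WeierstrassCurve.Affine.Point.add_self_of_Y_eq hy] at h2
      exact absurd h2 (WeierstrassCurve.Affine.Point.some_ne_zero hP).symm
    · rw [WeierstrassCurve.Affine.Point.add_self_of_Y_ne hy] at h2
      have hx : W.addX x x (W.slope x x y y) = xP :=
        (WeierstrassCurve.Affine.Point.some.injEq _ _ _ _ _ _).mp h2 |>.1
      rw [← hx, addX_self_mul_eq W h hy]
      ring

end Doubling

/-! ### §2 Irreducibility certificates for monic quartics -/

section Certificate

variable {F : Type*} [Field F]

/-- A monic quadratic is `X² + c₁X + c₀`. [folklore] -/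
theorem eq_X_sq_add_of_monic_of_natDegree_eq_two {q : F[X]} (hq : q.Monic) (h2 : q.natDegree = 2) :
    q = X ^ 2 + C (q.coeff 1) * X + C (q.coeff 0) := by
  ext n
  rcases n with _ | _ | _ | n
  · simp
  · simp
  · have : q.coeff 2 = 1 := by rw [← h2]; exact hq.coeff_natDegree
    simp [this]
  · have hlt : q.natDegree < n + 3 := by omega
    rw [Polynomial.coeff_eq_zero_of_natDegree_lt hlt]
    simp only [coeff_add, coeff_X_pow, coeff_C_mul, coeff_X, coeff_C]
    simp

/-- **Irreducibility of a monic quartic by certificate** (any field): `X⁴ + c₃X³ + c₂X² + c₁X + c₀` is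
irreducible if it has no root and, for all `a, b`, the remainder of its division by `X² + aX + b` —
namely `(c₁ − a d − b c)X + (c₀ − b d)` with `c = c₃ − a`, `d = c₂ − b − a c` — is non-zero. [folklore] -/
theorem irreducible_quartic_of_certificate (c₃ c₂ c₁ c₀ : F)
    (hroot : ∀ r : F, r ^ 4 + c₃ * r ^ 3 + c₂ * r ^ 2 + c₁ * r + c₀ ≠ 0)
    (hquad : ∀ a b : F,
      a * (c₂ - b - a * (c₃ - a)) + b * (c₃ - a) ≠ c₁ ∨ b * (c₂ - b - a * (c₃ - a)) ≠ c₀) :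
    Irreducible (X ^ 4 + C c₃ * X ^ 3 + C c₂ * X ^ 2 + C c₁ * X + C c₀ : F[X]) := by
  set P : F[X] := X ^ 4 + C c₃ * X ^ 3 + C c₂ * X ^ 2 + C c₁ * X + C c₀ with hPdef
  have hPm : P.Monic := by rw [hPdef]; monicity!
  have hPdeg : P.natDegree = 4 := by rw [hPdef]; compute_degree!
  have hP1 : P ≠ 1 := fun h ↦ by
    have := congrArg natDegree h
    rw [hPdeg, natDegree_one] at this
    exact absurd this (by norm_num)
  have heval : ∀ r : F, P.eval r = r ^ 4 + c₃ * r ^ 3 + c₂ * r ^ 2 + c₁ * r + c₀ := fun r ↦ by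
    rw [hPdef]; simp [eval_add, eval_mul, eval_pow, eval_C, eval_X]
  refine (hPm.irreducible_iff_lt_natDegree_lt hP1).2 fun q hq hdeg hdvd ↦ ?_
  rw [hPdeg, Finset.mem_Ioc] at hdeg
  rcases hdeg with ⟨h0, h2⟩
  interval_cases hqd : q.natDegree
  · -- a linear factor `X + C (q.coeff 0)` gives the root `-q.coeff 0`
    have hq1 := hq.eq_X_add_C hqd
    have hr : q.eval (-q.coeff 0) = 0 := by rw [hq1]; simp
    have hPr : P.eval (-q.coeff 0) = 0 := Polynomial.eval_eq_zero_of_dvd_of_eval_eq_zero hdvd hr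
    exact hroot _ (by rw [← heval]; exact hPr)
  · -- a monic quadratic factor `X² + aX + b`: the remainder must vanish
    set a := q.coeff 1 with ha
    set b := q.coeff 0 with hb
    have hq2 := eq_X_sq_add_of_monic_of_natDegree_eq_two hq hqd
    set Rm : F[X] := C (c₁ - a * (c₂ - b - a * (c₃ - a)) - b * (c₃ - a)) * X +
      C (c₀ - b * (c₂ - b - a * (c₃ - a))) with hRm
    have hdiv : P = q * (X ^ 2 + C (c₃ - a) * X + C (c₂ - b - a * (c₃ - a))) + Rm := by
      rw [hPdef, hq2, hRm]
      simp only [map_sub, map_mul]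
      ring
    have hdvdR : q ∣ Rm := by
      have h1 : q ∣ P - q * (X ^ 2 + C (c₃ - a) * X + C (c₂ - b - a * (c₃ - a))) :=
        dvd_sub hdvd (dvd_mul_right _ _)
      rwa [hdiv, add_sub_cancel_left] at h1
    have hRdeg : Rm.natDegree < q.natDegree := by
      rw [hqd]
      calc Rm.natDegree ≤ 1 := by rw [hRm]; compute_degree!
        _ < 2 := by norm_num
    have hR0 : Rm = 0 := Polynomial.eq_zero_of_dvd_of_natDegree_lt hdvdR hRdeg
    have hc1 : Rm.coeff 1 = 0 := by rw [hR0, coeff_zero]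
    have hc0 : Rm.coeff 0 = 0 := by rw [hR0, coeff_zero]
    rw [hRm] at hc1 hc0
    simp only [coeff_add, coeff_C_mul, coeff_X_one, mul_one, coeff_C_succ, add_zero,
      coeff_X_zero, mul_zero, coeff_C_zero, zero_add] at hc1 hc0
    rcases hquad a b with h | h
    · exact h (by linear_combination -hc1)
    · exact h (by linear_combination -hc0)

/-- **Integer quartics: irreducible over `ℚ` by a certificate modulo a prime `p`** (`X⁴ + c₃X³ + ⋯`
monic over `ℤ`; the two `decide`-shaped checks over `ZMod p` — no root, no monic quadratic factor —
give irreducibility over `𝔽_p` (`irreducible_quartic_of_certificate`), hence over `ℤ`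
(`Polynomial.Monic.irreducible_of_irreducible_map`), hence over `ℚ` (Gauss's lemma
`Monic.irreducible_iff_irreducible_map_fraction_map`). The hypotheses only use the ring structure of
`ZMod p`, so that `decide` closes them on literals. [folklore] -/
theorem irreducible_quartic_rat_of_certificate (c₃ c₂ c₁ c₀ : ℤ) {p : ℕ} (hp : p.Prime)
    (hroot : ∀ r : ZMod p, r ^ 4 + (c₃ : ZMod p) * r ^ 3 + (c₂ : ZMod p) * r ^ 2 +
      (c₁ : ZMod p) * r + (c₀ : ZMod p) ≠ 0)
    (hquad : ∀ a b : ZMod p,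
      a * ((c₂ : ZMod p) - b - a * ((c₃ : ZMod p) - a)) + b * ((c₃ : ZMod p) - a) ≠ (c₁ : ZMod p) ∨
        b * ((c₂ : ZMod p) - b - a * ((c₃ : ZMod p) - a)) ≠ (c₀ : ZMod p)) :
    Irreducible (X ^ 4 + C (c₃ : ℚ) * X ^ 3 + C (c₂ : ℚ) * X ^ 2 + C (c₁ : ℚ) * X + C (c₀ : ℚ) :
      ℚ[X]) := by
  haveI : Fact p.Prime := ⟨hp⟩
  have hirr : Irreducible (X ^ 4 + C (c₃ : ZMod p) * X ^ 3 + C (c₂ : ZMod p) * X ^ 2 +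
      C (c₁ : ZMod p) * X + C (c₀ : ZMod p) : (ZMod p)[X]) :=
    irreducible_quartic_of_certificate _ _ _ _ hroot hquad
  set P : ℤ[X] := X ^ 4 + C c₃ * X ^ 3 + C c₂ * X ^ 2 + C c₁ * X + C c₀ with hPdef
  have hPm : P.Monic := by rw [hPdef]; monicity!
  have hmapP : ∀ {S : Type} [CommRing S] (f : ℤ →+* S), P.map f =
      X ^ 4 + C (f c₃) * X ^ 3 + C (f c₂) * X ^ 2 + C (f c₁) * X + C (f c₀) := by
    intro S _ f
    rw [hPdef]
    simp [Polynomial.map_add, Polynomial.map_mul, Polynomial.map_pow]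
  have hZ : Irreducible P := by
    refine hPm.irreducible_of_irreducible_map (Int.castRingHom (ZMod p)) P ?_
    rw [hmapP]
    simpa using hirr
  have hQ := (hPm.irreducible_iff_irreducible_map_fraction_map (K := ℚ)).mp hZ
  rw [hmapP] at hQ
  simpa using hQ

end Certificate

/-! ### §3 No half over a quadratic field -/

section Quadratic

/-- **A rational point whose halving quartic is irreducible over `ℚ` has no half over any quadratic
number field.** `W/ℚ`, `K` a number field with `[K:ℚ] = 2`, `P = (x_P, y_P)` with `x_P, y_P ∈ ℚ` read in
`E(K)`; if the (monic, integer) quartic `X⁴ + c₃X³ + c₂X² + c₁X + c₀` with `c₃ = −4x_P`,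
`c₂ = −b₄ − x_P b₂`, `c₁ = −2b₆ − 2x_P b₄`, `c₀ = −b₈ − x_P b₆` is irreducible over `ℚ`, then
`R + R ≠ P` for every `R ∈ E(K)`: the `x`-coordinate of a half is a root (`exists_halvingQuartic_eq_zero`),
hence has minimal polynomial of degree `4 > [K:ℚ]`. [cite: SilvermanAEC2009, III.2.3 (d), VIII.1] -/
theorem not_exists_add_self_eq_of_irreducible (W : WeierstrassCurve ℚ) (K : Type) [Field K]
    [NumberField K] (hK2 : Module.finrank ℚ K = 2) {xP yP : ℚ}
    (hP : (W.baseChange K).toAffine.Nonsingular (algebraMap ℚ K xP) (algebraMap ℚ K yP))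
    {c₃ c₂ c₁ c₀ : ℤ} (hc₃ : (c₃ : ℚ) = -4 * xP) (hc₂ : (c₂ : ℚ) = -W.b₄ - xP * W.b₂)
    (hc₁ : (c₁ : ℚ) = -2 * W.b₆ - 2 * xP * W.b₄) (hc₀ : (c₀ : ℚ) = -W.b₈ - xP * W.b₆)
    (hirr : Irreducible (X ^ 4 + C (c₃ : ℚ) * X ^ 3 + C (c₂ : ℚ) * X ^ 2 + C (c₁ : ℚ) * X +
      C (c₀ : ℚ) : ℚ[X])) :
    ¬ ∃ R : (W.baseChange K).toAffine.Point, R + R = .some _ _ hP := by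
  rintro ⟨R, hR⟩
  obtain ⟨x, y, h, -, hx⟩ := exists_halvingQuartic_eq_zero (W.baseChange K).toAffine hR
  -- the quartic over `ℚ` and its evaluation at `x`
  set Q : ℚ[X] := X ^ 4 + C (c₃ : ℚ) * X ^ 3 + C (c₂ : ℚ) * X ^ 2 + C (c₁ : ℚ) * X + C (c₀ : ℚ)
    with hQdef
  have hQm : Q.Monic := by rw [hQdef]; monicity!
  have hQdeg : Q.natDegree = 4 := by rw [hQdef]; compute_degree!
  have hb₂ : (W.baseChange K).b₂ = algebraMap ℚ K W.b₂ := by simp [WeierstrassCurve.baseChange]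
  have hb₄ : (W.baseChange K).b₄ = algebraMap ℚ K W.b₄ := by simp [WeierstrassCurve.baseChange]
  have hb₆ : (W.baseChange K).b₆ = algebraMap ℚ K W.b₆ := by simp [WeierstrassCurve.baseChange]
  have hb₈ : (W.baseChange K).b₈ = algebraMap ℚ K W.b₈ := by simp [WeierstrassCurve.baseChange]
  have haeval : aeval x Q = 0 := by
    rw [hQdef]
    simp only [map_add, map_mul, aeval_X_pow, aeval_C, aeval_X]
    rw [hc₃, hc₂, hc₁, hc₀]
    change (W.baseChange K).toAffine.b₂ = _ at hb₂
    change (W.baseChange K).toAffine.b₄ = _ at hb₄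
    change (W.baseChange K).toAffine.b₆ = _ at hb₆
    change (W.baseChange K).toAffine.b₈ = _ at hb₈
    rw [hb₂, hb₄, hb₆, hb₈] at hx
    simp only [map_neg, map_sub, map_mul, map_ofNat] at hx ⊢
    linear_combination hx
  have hmin : Q = minpoly ℚ x := minpoly.eq_of_irreducible_of_monic hirr haeval hQm
  have hle : (minpoly ℚ x).natDegree ≤ Module.finrank ℚ K := minpoly.natDegree_le x
  rw [← hmin, hQdeg, hK2] at hle
  exact absurd hle (by norm_num)

end Quadratic

end Summit.BirchSwinnertonDyer.BirchSwinnertonDyer.Theorems.GenusExact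

end
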